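import Literature.NumberTheory.LFunctions.GaussianHeckeLSeries
import Literature.NumberTheory.QuadraticFields.GaussianPrimary
import HarnessLib

/-!
# Von Mangoldt calculus on `ℤ[i]` in the primary normalisation, twisted by a multiplicative weight: `D_ψ = ψ(1) e^{Q_ψ}`

Topic `Literature/NumberTheory/LFunctions`, after the models `GaussianHeckeVonMangoldt.lean` and
`GaussianHeckeLSeries.lean` (the angular characters `λ^m = (z/|z|)^{4m}`, all nonzero `z`, first-quadrant
primes). Here the normalisation is by PRIMARY elements (`z ≡ 1 (mod 2 + 2i)`, one representative per
odd associate class — `Literature.NumberTheory.QuadraticFields.GaussianPrimary`) and the weight is any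
`ψ : ℤ[i] → ℂ` multiplicative on primary elements with `|ψ| ≤ 1` there — the Hecke characters
`ψ(z) = χ(z) (z/|z|)^m` of §16 of Friedlander–Iwaniec (Ann. of Math. 148 (1998)), (16.16): "defines
a character on odd ideals of `ℤ[i]` by setting `ψ(𝔞) = ψ(z)` where `z` is the unique generator of `𝔞`
which is primary … Since `ψ` is completely multiplicative `L` has the Euler product
`L(s, ψ) = ∏_𝔭 (1 - ψ(𝔭)(N𝔭)^{-s})⁻¹`" and (16.30) "`λ(n) = ∑_{N𝔞 = n} ψ(𝔞)`". Everything is PROVED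
from unique factorisation in `ℤ[i]`; no named facts.

* `primesP B` (primary primes of norm `≤ B`, one per ODD prime ideal), `pairsDivP`, `pairsNormP`;
  **`∑_π v_π(z) log N(π) = log N(z)`** for odd `z ≠ 0` (`sum_multiplicity_mul_log`) and
  **`∑_{(π,j) : π^j ∣ z} log N(π) = log N(z)`** (`sum_pairsDivP_log`);
* `IsPrimaryMul ψ` (`ψ(xy) = ψ(x)ψ(y)` for primary `x, y`), `isPrimary_div`;
* the coefficients `cCoeffP ψ n = ∑_{x ∈ primaryNormEq n} ψ(x)` (`= λ(n)` of (16.30)),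
  `lCoeffP ψ n = ∑_{N(π)^j = n} log N(π) ψ(π)^j`, and the **convolution identity**
  `(c_ψ ⋆ l_ψ)(n) = log n · c_ψ(n)` (`convolution_cCoeffP_lCoeffP`);
* the Dirichlet series `dSeries ψ = L(c_ψ, ·)` (`= L(s, ψ)` for `Re s > 1`), `pSeries ψ = L(l_ψ, ·)`,
  `qSeries ψ = L(q_ψ, ·)` (`q_ψ(n) = ∑ j⁻¹ ψ(π)^j`), all absolutely convergent for `Re s > 1`
  (majorant `#normEq n`, the tree's `GaussianHecke.LSeriesSummable_cCoeff 0`); `Q_ψ' = -P_ψ`,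
  **`D_ψ' = -D_ψ P_ψ`** (`hasDerivAt_dSeries`), **`D_ψ(s) = ψ(1) exp(Q_ψ(s))`** (`dSeries_eq_mul_exp`:
  the Euler product in logarithmic form, by the zero-derivative argument of the model), hence
  **`D_ψ(s) ≠ 0`** and `P_ψ = -D_ψ'/D_ψ` for `Re s > 1` when `ψ(1) ≠ 0`, and
  `‖D_ψ(s)‖ = exp(Re Q_ψ(s))` when `ψ(1) = 1` — the inputs "`F ≠ 0`, `F'/F = -L(Λ₁, ·)` on `σ > 1`",
  "`|F| ≥ c₁(σ - 1)`" and "3-4-1" of the zero-free-region argument (`TwistedZeroFreeRegion.lean`)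
  for the Hecke `L`-functions of `ℚ(i)` modulo `4d`.

## References

* E. Hecke, *Eine neue Art von Zetafunktionen …. II*, Math. Z. 6 (1920), 11–51, §7. [HeckeMathZ1920]
* J. Friedlander, H. Iwaniec, Ann. of Math. (2) 148 (1998), 945–1040, §16 (16.16)–(16.17), (16.30).
  [FriedlanderIwaniecAnnals1998]

## Mathlib / tree

Mathlib: `UniqueFactorizationMonoid.induction_on_prime`, `multiplicity_mul`, `LSeries_hasDerivAt`,
`LSeries_convolution'`, `LSeries.tendsto_atTop`, `Convex.is_const_of_fderivWithin_eq_zero`.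
Tree: `GaussianHecke.{isUnit_iff_norm_eq_one, two_le_norm_of_prime, natAbs_norm_cast,
filter_pow_dvd_eq_Icc, LSeriesSummable_cCoeff, abscissa_cCoeff_le, cCoeff_zero, halfPlane_mem_nhds}`,
`GaussianTheta.normEq`, `GaussianInt.normLE`; `GaussianPrimary.{IsPrimary, primary, isPrimary_primary,
associated_primary, norm_primary, primary_eq_of_associated, IsPrimary.eq_of_associated, IsPrimary.mul,
IsPrimary.pow, IsPrimary.odd, parity_mul, primaryNormEq, primaryNormEq_one}`.
-/

noncomputable section

open Finset Complex Filter Topology LSeries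

namespace Literature.NumberTheory.LFunctions

namespace GaussianPrimaryVM

open GaussianInt GaussianTheta GaussianHecke
open Literature.NumberTheory.QuadraticFields.GaussianPrimary

local notation "ℤ[i]" => _root_.GaussianInt

open scoped Classical

/-! ### Odd Gaussian integers and primary primes -/

/-- `z` is odd (prime to `1 + i`) iff `re z + im z` is odd; the norm has the same parity. [folklore] -/
theorem odd_iff_norm_odd (z : ℤ[i]) : (z.re + z.im) % 2 = 1 ↔ z.norm % 2 = 1 := by
  rw [norm_emod_two]

/-- A product is odd iff both factors are. [folklore] -/
theorem odd_mul_iff (x y : ℤ[i]) :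
    ((x * y).re + (x * y).im) % 2 = 1 ↔ (x.re + x.im) % 2 = 1 ∧ (y.re + y.im) % 2 = 1 := by
  rw [parity_mul]
  have hx := Int.emod_two_eq_zero_or_one (x.re + x.im)
  have hy := Int.emod_two_eq_zero_or_one (y.re + y.im)
  rcases hx with hx | hx <;> rcases hy with hy | hy <;> simp [hx, hy]

/-- A unit is odd. [folklore] -/
theorem odd_of_isUnit {u : ℤ[i]} (hu : IsUnit u) : (u.re + u.im) % 2 = 1 := by
  rw [odd_iff_norm_odd, isUnit_iff_norm_eq_one.mp hu]
  decide

/-- The primary Gaussian primes of norm `≤ B` (one representative per ODD prime ideal). [folklore] -/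
def primesP (B : ℕ) : Finset ℤ[i] :=
  (normLE (B : ℝ)).filter fun π ↦ Prime π ∧ IsPrimary π

/-- Membership in `primesP`. [folklore] -/
theorem mem_primesP {B : ℕ} {π : ℤ[i]} :
    π ∈ primesP B ↔ Prime π ∧ IsPrimary π ∧ π.norm ≤ B := by
  rw [primesP, mem_filter, mem_normLE]
  constructor
  · rintro ⟨h1, h2, h3⟩
    exact ⟨h2, h3, by exact_mod_cast h1⟩
  · rintro ⟨h2, h3, h1⟩
    exact ⟨by exact_mod_cast h1, h2, h3⟩

/-- The primary associate of an odd prime is a primary prime of the same norm. [folklore] -/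
theorem primary_mem_primesP {p : ℤ[i]} (hp : Prime p) (hodd : (p.re + p.im) % 2 = 1) {B : ℕ}
    (hB : p.norm.natAbs ≤ B) : primary p ∈ primesP B := by
  refine mem_primesP.mpr ⟨(associated_primary hodd).prime hp, isPrimary_primary hodd, ?_⟩
  rw [norm_primary hodd]
  have := natAbs_norm_cast p
  omega

/-- The multiplicity of the primary associate of an odd prime `p` in `p` is `1`. [folklore] -/
theorem multiplicity_primary_self {p : ℤ[i]} (hp : Prime p) (hodd : (p.re + p.im) % 2 = 1) :
    multiplicity (primary p) p = 1 := by
  have hq : Prime (primary p) := (associated_primary hodd).prime hp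
  obtain ⟨v, hv⟩ := (associated_primary hodd).symm
  calc multiplicity (primary p) p = multiplicity (primary p) (primary p * ↑v) := by rw [hv]
    _ = multiplicity (primary p) (primary p) + multiplicity (primary p) ↑v :=
        multiplicity_mul hq (by rw [hv]; exact FiniteMultiplicity.of_prime_left hq hp.ne_zero)
    _ = 1 := by rw [multiplicity_self, multiplicity_of_unit_right hq.not_unit v]

/-- For an odd prime `p`: `∑_{π ∈ primesP B} v_π(p) log N(π) = log N(p)` when `N(p) ≤ B` (only
`π = primary p` contributes). [folklore] -/
theorem sum_multiplicity_prime {p : ℤ[i]} (hp : Prime p) (hodd : (p.re + p.im) % 2 = 1) {B : ℕ}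
    (hB : p.norm.natAbs ≤ B) :
    ∑ π ∈ primesP B, (multiplicity π p : ℝ) * Real.log (π.norm : ℝ) = Real.log (p.norm : ℝ) := by
  rw [sum_eq_single (primary p)]
  · rw [multiplicity_primary_self hp hodd, norm_primary hodd, Nat.cast_one, one_mul]
  · intro π hπ hne
    obtain ⟨hπp, hπq, -⟩ := mem_primesP.mp hπ
    have hndvd : ¬π ∣ p := fun hdvd ↦ hne (by
      have hassoc : Associated π p := hπp.associated_of_dvd hp hdvd
      exact (primary_eq_of_associated hassoc.symm hπq).symm)
    rw [multiplicity_eq_zero.mpr hndvd, Nat.cast_zero, zero_mul]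
  · intro hnot
    exact absurd (primary_mem_primesP hp hodd hB) hnot

/-- **`∑_{π primary prime} v_π(z) log N(π) = log N(z)`** for odd `z ≠ 0` (`π` over `primesP B`, any
`B ≥ N(z)`): unique factorisation in `ℤ[i]`. [folklore] -/
theorem sum_multiplicity_mul_log (z : ℤ[i]) (hz : z ≠ 0) (hodd : (z.re + z.im) % 2 = 1) {B : ℕ}
    (hB : z.norm.natAbs ≤ B) :
    ∑ π ∈ primesP B, (multiplicity π z : ℝ) * Real.log (π.norm : ℝ) = Real.log (z.norm : ℝ) := by
  revert hz hodd B
  induction z using UniqueFactorizationMonoid.induction_on_prime with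
  | h₁ => intro h; exact absurd rfl h
  | h₂ u hu =>
      intro _ _ B _
      have hN : u.norm = 1 := isUnit_iff_norm_eq_one.mp hu
      rw [hN, Int.cast_one, Real.log_one]
      refine sum_eq_zero fun π hπ ↦ ?_
      rw [multiplicity_of_isUnit_right (mem_primesP.mp hπ).1.not_unit hu, Nat.cast_zero,
        zero_mul]
  | h₃ a p ha hp ih =>
      intro _ hodd B hB
      have hpa : p * a ≠ 0 := mul_ne_zero hp.ne_zero ha
      obtain ⟨hoddp, hodda⟩ := (odd_mul_iff p a).mp hodd
      have hNp : 0 < p.norm := GaussianInt.norm_pos.mpr hp.ne_zero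
      have hNa : 0 < a.norm := GaussianInt.norm_pos.mpr ha
      have hcast := natAbs_norm_cast (p * a)
      have hcasta := natAbs_norm_cast a
      have hcastp := natAbs_norm_cast p
      rw [Zsqrtd.norm_mul] at hcast
      have hBa : a.norm.natAbs ≤ B := by
        have : (a.norm.natAbs : ℤ) ≤ (p * a).norm.natAbs := by
          rw [hcasta, natAbs_norm_cast, Zsqrtd.norm_mul]; nlinarith
        omega
      have hBp : p.norm.natAbs ≤ B := by
        have : (p.norm.natAbs : ℤ) ≤ (p * a).norm.natAbs := by
          rw [hcastp, natAbs_norm_cast, Zsqrtd.norm_mul]; nlinarith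
        omega
      have hsplit : ∀ π ∈ primesP B, (multiplicity π (p * a) : ℝ) * Real.log (π.norm : ℝ) =
          (multiplicity π p : ℝ) * Real.log (π.norm : ℝ) +
            (multiplicity π a : ℝ) * Real.log (π.norm : ℝ) := fun π hπ ↦ by
        have hπ' := (mem_primesP.mp hπ).1
        rw [multiplicity_mul hπ' (FiniteMultiplicity.of_prime_left hπ' hpa)]
        push_cast
        ring
      rw [sum_congr rfl hsplit, sum_add_distrib, ih ha hodda hBa, sum_multiplicity_prime hp hoddp hBp,
        Zsqrtd.norm_mul, Int.cast_mul, Real.log_mul]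
      · exact_mod_cast hNp.ne'
      · exact_mod_cast hNa.ne'

/-! ### Prime-power pairs -/

/-- The pairs `(π, j)`, `π` a primary prime of norm `≤ B`, `1 ≤ j ≤ B`, with `π^j ∣ z`. [folklore] -/
def pairsDivP (B : ℕ) (z : ℤ[i]) : Finset (ℤ[i] × ℕ) :=
  (primesP B ×ˢ Icc 1 B).filter fun p ↦ p.1 ^ p.2 ∣ z

/-- Membership in `pairsDivP`. [folklore] -/
theorem mem_pairsDivP {B : ℕ} {z : ℤ[i]} {p : ℤ[i] × ℕ} :
    p ∈ pairsDivP B z ↔ p.1 ∈ primesP B ∧ p.2 ∈ Icc 1 B ∧ p.1 ^ p.2 ∣ z := by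
  rw [pairsDivP, mem_filter, mem_product, and_assoc]

/-- The pairs `(π, j)`, `π` a primary prime, `j ≥ 1`, with `N(π)^j = n`. [folklore] -/
def pairsNormP (n : ℕ) : Finset (ℤ[i] × ℕ) :=
  (primesP n ×ˢ Icc 1 n).filter fun p ↦ p.1.norm.natAbs ^ p.2 = n

/-- Membership in `pairsNormP`. [folklore] -/
theorem mem_pairsNormP {n : ℕ} {p : ℤ[i] × ℕ} :
    p ∈ pairsNormP n ↔ p.1 ∈ primesP n ∧ p.2 ∈ Icc 1 n ∧ p.1.norm.natAbs ^ p.2 = n := by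
  rw [pairsNormP, mem_filter, mem_product, and_assoc]

/-- For a primary prime `π` and `j ≥ 1`: `(π, j) ∈ pairsNormP (N(π)^j)`. [folklore] -/
theorem mem_pairsNormP_of {π : ℤ[i]} (hπ : Prime π) (hq : IsPrimary π) {j : ℕ} (hj : 1 ≤ j) :
    (π, j) ∈ pairsNormP (π.norm.natAbs ^ j) := by
  have h2 : 2 ≤ π.norm.natAbs := by
    have := two_le_norm_of_prime hπ
    have := natAbs_norm_cast π
    omega
  have hj' : j ≤ π.norm.natAbs ^ j :=
    (Nat.lt_two_pow_self).le.trans (Nat.pow_le_pow_left h2 j)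
  have hN : π.norm.natAbs ≤ π.norm.natAbs ^ j := by
    calc π.norm.natAbs = π.norm.natAbs ^ 1 := (pow_one _).symm
      _ ≤ π.norm.natAbs ^ j := Nat.pow_le_pow_right (by omega) hj
  refine mem_pairsNormP.mpr ⟨mem_primesP.mpr ⟨hπ, hq, ?_⟩, mem_Icc.mpr ⟨hj, hj'⟩, rfl⟩
  calc π.norm = (π.norm.natAbs : ℤ) := (natAbs_norm_cast π).symm
    _ ≤ ((π.norm.natAbs ^ j : ℕ) : ℤ) := by exact_mod_cast hN

/-- **`∑_{(π, j) : π^j ∣ z} log N(π) = log N(z)`** for odd `z ≠ 0` (pairs from `pairsDivP B z`, any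
`B ≥ N(z)`). [folklore] -/
theorem sum_pairsDivP_log (z : ℤ[i]) (hz : z ≠ 0) (hodd : (z.re + z.im) % 2 = 1) {B : ℕ}
    (hB : z.norm.natAbs ≤ B) :
    ∑ p ∈ pairsDivP B z, Real.log (p.1.norm : ℝ) = Real.log (z.norm : ℝ) := by
  rw [pairsDivP, sum_filter, sum_product, ← sum_multiplicity_mul_log z hz hodd hB]
  refine sum_congr rfl fun π hπ ↦ ?_
  rw [← sum_filter, filter_pow_dvd_eq_Icc (mem_primesP.mp hπ).1 hz hB]
  simp only [sum_const, Nat.card_Icc, Nat.add_sub_cancel, nsmul_eq_mul]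

/-! ### Multiplicative weights on primary elements -/

/-- A weight `ψ : ℤ[i] → ℂ` multiplicative on primary elements (model: `χ(z) (z/|z|)^k`).
[cite: FriedlanderIwaniecAnnals1998, (16.16)] -/
def IsPrimaryMul (ψ : ℤ[i] → ℂ) : Prop :=
  ∀ x y : ℤ[i], IsPrimary x → IsPrimary y → ψ (x * y) = ψ x * ψ y

/-- Powers: `ψ(π^j) = ψ(π)^j` for `π` primary, `j ≥ 1`. [folklore] -/
theorem IsPrimaryMul.map_pow {ψ : ℤ[i] → ℂ} (hψ : IsPrimaryMul ψ) {π : ℤ[i]} (hπ : IsPrimary π)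
    {j : ℕ} (hj : 1 ≤ j) : ψ (π ^ j) = ψ π ^ j := by
  induction j with
  | zero => exact absurd hj (by norm_num)
  | succ j ih =>
    rcases Nat.eq_zero_or_pos j with rfl | hj0
    · simp
    · rw [pow_succ, hψ _ _ (hπ.pow j) hπ, ih hj0, pow_succ]

/-- Quotients: `z`, `w` primary, `w ∣ z` ⇒ `z / w` primary (`2 + 2i ∣ (z - 1) - (w - 1)(z/w) = z/w - 1`).
[folklore] -/
theorem isPrimary_div {z w : ℤ[i]} (hz : IsPrimary z) (hw : IsPrimary w) (hdvd : w ∣ z) :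
    IsPrimary (z / w) := by
  have hw0 : w ≠ 0 := hw.ne_zero
  set q : ℤ[i] := z / w with hqdef
  have hq : w * q = z := EuclideanDomain.mul_div_cancel' hw0 hdvd
  rw [isPrimary_iff_dvd] at hz hw ⊢
  rw [← hq] at hz
  have : q - 1 = (w * q - 1) - (w - 1) * q := by ring
  rw [this]
  exact dvd_sub hz (hw.mul_right _)

/-! ### The Dirichlet coefficients and the convolution identity -/

/-- The primary elements of norm `n`: `(normEq n).filter IsPrimary = primaryNormEq n`. [folklore] -/
theorem filter_isPrimary_normEq (n : ℕ) : (normEq n).filter IsPrimary = primaryNormEq n := by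
  ext x
  rw [mem_filter, mem_normEq, mem_primaryNormEq]

/-- `c_ψ(n) = ∑_{x primary, N(x) = n} ψ(x)` — the `n`-th coefficient of `L(s, ψ)` (FI's Hecke
eigenvalue `λ(n)` of (16.30) for `ψ = χ · (z/|z|)^m`). [cite: FriedlanderIwaniecAnnals1998, (16.30)] -/
def cCoeffP (ψ : ℤ[i] → ℂ) (n : ℕ) : ℂ := ∑ x ∈ primaryNormEq n, ψ x

/-- `l_ψ(n) = ∑_{(π, j) : N(π)^j = n} log N(π) ψ(π)^j` — the `n`-th coefficient of `-L'/L(s, ψ)`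
(`π` over primary primes, `j ≥ 1`). [folklore] -/
def lCoeffP (ψ : ℤ[i] → ℂ) (n : ℕ) : ℂ :=
  ∑ p ∈ pairsNormP n, (Real.log (p.1.norm : ℝ) : ℂ) * ψ p.1 ^ p.2

/-- The triples `(x, π, j)` with `x` primary, `N(x) N(π)^j = n`. [folklore] -/
def triplesLP (n : ℕ) : Finset (ℤ[i] × (ℤ[i] × ℕ)) :=
  ((normLE (n : ℝ)).filter IsPrimary ×ˢ (primesP n ×ˢ Icc 1 n)).filter
    fun t ↦ t.1.norm.natAbs * t.2.1.norm.natAbs ^ t.2.2 = n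

/-- The triples `(z, π, j)` with `z` primary, `N(z) = n`, `π^j ∣ z`. [folklore] -/
def triplesRP (n : ℕ) : Finset (ℤ[i] × (ℤ[i] × ℕ)) :=
  ((normEq n).filter IsPrimary ×ˢ (primesP n ×ˢ Icc 1 n)).filter fun t ↦ t.2.1 ^ t.2.2 ∣ t.1

/-- Membership in `triplesLP`. [folklore] -/
theorem mem_triplesLP {n : ℕ} {t : ℤ[i] × (ℤ[i] × ℕ)} :
    t ∈ triplesLP n ↔ ((t.1.norm ≤ n ∧ IsPrimary t.1) ∧ (t.2.1 ∈ primesP n ∧ t.2.2 ∈ Icc 1 n)) ∧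
      t.1.norm.natAbs * t.2.1.norm.natAbs ^ t.2.2 = n := by
  rw [triplesLP, mem_filter, mem_product, mem_product, mem_filter, mem_normLE]
  constructor
  · rintro ⟨⟨⟨h1, h1'⟩, h23⟩, h4⟩
    exact ⟨⟨⟨by exact_mod_cast h1, h1'⟩, h23⟩, h4⟩
  · rintro ⟨⟨⟨h1, h1'⟩, h23⟩, h4⟩
    exact ⟨⟨⟨by exact_mod_cast h1, h1'⟩, h23⟩, h4⟩

/-- Membership in `triplesRP`. [folklore] -/
theorem mem_triplesRP {n : ℕ} {t : ℤ[i] × (ℤ[i] × ℕ)} :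
    t ∈ triplesRP n ↔ ((t.1.norm = n ∧ IsPrimary t.1) ∧ (t.2.1 ∈ primesP n ∧ t.2.2 ∈ Icc 1 n)) ∧
      t.2.1 ^ t.2.2 ∣ t.1 := by
  rw [triplesRP, mem_filter, mem_product, mem_product, mem_filter, mem_normEq]

/-- The left side of the convolution as a sum over `triplesLP`. [folklore] -/
theorem convolution_eq_sum_triplesLP (ψ : ℤ[i] → ℂ) {n : ℕ} (hn : n ≠ 0) :
    LSeries.convolution (cCoeffP ψ) (lCoeffP ψ) n =
      ∑ t ∈ triplesLP n, ψ t.1 * ((Real.log (t.2.1.norm : ℝ) : ℂ) * ψ t.2.1 ^ t.2.2) := by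
  rw [LSeries.convolution_def]
  have hfib : ∀ de ∈ n.divisorsAntidiagonal,
      (triplesLP n).filter (fun t ↦ (t.1.norm.natAbs, t.2.1.norm.natAbs ^ t.2.2) = de) =
        (normEq de.1).filter IsPrimary ×ˢ pairsNormP de.2 := by
    rintro ⟨d, e⟩ hde
    obtain ⟨hmul, -⟩ := Nat.mem_divisorsAntidiagonal.mp hde
    simp only at hmul
    have hdn : d ≤ n := Nat.le_of_dvd (Nat.pos_of_ne_zero hn) ⟨e, hmul.symm⟩
    have hen : e ≤ n := Nat.le_of_dvd (Nat.pos_of_ne_zero hn) ⟨d, by rw [mul_comm]; exact hmul.symm⟩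
    ext ⟨x, π, j⟩
    simp only [mem_filter, mem_triplesLP, mem_product, mem_normEq, mem_pairsNormP, Prod.mk.injEq]
    constructor
    · rintro ⟨⟨⟨⟨-, hxP⟩, hπ, hj⟩, -⟩, hxd, hπe⟩
      obtain ⟨hP, hQ, -⟩ := mem_primesP.mp hπ
      obtain ⟨hj1, -⟩ := mem_Icc.mp hj
      have key := mem_pairsNormP.mp (mem_pairsNormP_of hP hQ hj1)
      rw [hπe] at key
      refine ⟨⟨?_, hxP⟩, key.1, key.2.1, hπe⟩
      rw [← hxd]
      exact (natAbs_norm_cast x).symm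
    · rintro ⟨⟨hxd, hxP⟩, hπ, hj, hπe⟩
      obtain ⟨hP, hQ, hπle⟩ := mem_primesP.mp hπ
      obtain ⟨hj1, hje⟩ := mem_Icc.mp hj
      have hxd' : x.norm.natAbs = d := by
        have := natAbs_norm_cast x
        omega
      refine ⟨⟨⟨⟨?_, hxP⟩, mem_primesP.mpr ⟨hP, hQ, ?_⟩, mem_Icc.mpr ⟨hj1, hje.trans hen⟩⟩, ?_⟩, hxd', hπe⟩
      · rw [hxd]; exact_mod_cast hdn
      · exact hπle.trans (by exact_mod_cast hen)
      · rw [hxd', hπe, hmul]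
  have hmaps : ∀ t ∈ triplesLP n,
      (t.1.norm.natAbs, t.2.1.norm.natAbs ^ t.2.2) ∈ n.divisorsAntidiagonal := fun t ht ↦
    Nat.mem_divisorsAntidiagonal.mpr ⟨(mem_triplesLP.mp ht).2, hn⟩
  rw [← sum_fiberwise_of_maps_to hmaps]
  refine sum_congr rfl fun de hde ↦ ?_
  rw [hfib de hde, cCoeffP, ← filter_isPrimary_normEq, lCoeffP, sum_mul_sum, sum_product]

/-- The right side `log n · c_ψ(n)` as a sum over `triplesRP` (via `sum_pairsDivP_log`). [folklore] -/
theorem logMul_eq_sum_triplesRP (ψ : ℤ[i] → ℂ) (n : ℕ) :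
    (Real.log n : ℂ) * cCoeffP ψ n =
      ∑ t ∈ triplesRP n, ψ t.1 * (Real.log (t.2.1.norm : ℝ) : ℂ) := by
  rw [cCoeffP, ← filter_isPrimary_normEq, mul_sum]
  conv_rhs => rw [triplesRP, sum_filter, sum_product]
  refine sum_congr rfl fun z hz ↦ ?_
  rw [mem_filter, mem_normEq] at hz
  obtain ⟨hz, hzP⟩ := hz
  have hz0 : z ≠ 0 := hzP.ne_zero
  have hB : z.norm.natAbs ≤ n := by rw [hz, Int.natAbs_natCast]
  rw [← sum_filter, show (primesP n ×ˢ Icc 1 n).filter (fun q : ℤ[i] × ℕ ↦ q.1 ^ q.2 ∣ z) =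
      pairsDivP n z from rfl]
  dsimp only
  rw [← mul_sum, mul_comm]
  congr 1
  rw [← Complex.ofReal_sum, sum_pairsDivP_log z hz0 hzP.odd hB, hz, Int.cast_natCast]

/-- **The convolution identity `ψ ⋆ (Λ ψ) = ψ · log N` on the level of norms**:
`(c_ψ ⋆ l_ψ)(n) = log n · c_ψ(n)` for every `n`, for `ψ` multiplicative on primary elements — the
coefficient form of `-L'(s, ψ) = L(s, ψ) · P_ψ(s)`. [cite: HeckeMathZ1920, §7] -/
theorem convolution_cCoeffP_lCoeffP {ψ : ℤ[i] → ℂ} (hψ : IsPrimaryMul ψ) (n : ℕ) :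
    LSeries.convolution (cCoeffP ψ) (lCoeffP ψ) n = (Real.log n : ℂ) * cCoeffP ψ n := by
  rcases eq_or_ne n 0 with rfl | hn
  · simp
  rw [convolution_eq_sum_triplesLP ψ hn, logMul_eq_sum_triplesRP ψ n]
  refine sum_nbij' (fun t ↦ (t.1 * t.2.1 ^ t.2.2, t.2)) (fun t ↦ (t.1 / t.2.1 ^ t.2.2, t.2))
    ?_ ?_ ?_ ?_ ?_
  · rintro ⟨x, π, j⟩ ht
    obtain ⟨⟨⟨hx, hxP⟩, hπ, hj⟩, hprod⟩ := mem_triplesLP.mp ht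
    have hπP := (mem_primesP.mp hπ).2.1
    refine mem_triplesRP.mpr ⟨⟨⟨?_, hxP.mul (hπP.pow j)⟩, hπ, hj⟩, dvd_mul_left _ _⟩
    show (x * π ^ j).norm = n
    rw [Zsqrtd.norm_mul, norm_pow', ← natAbs_norm_cast x, ← natAbs_norm_cast π]
    exact_mod_cast hprod
  · rintro ⟨z, π, j⟩ ht
    obtain ⟨⟨⟨hz, hzP⟩, hπ, hj⟩, hdvd⟩ := mem_triplesRP.mp ht
    have hπP := (mem_primesP.mp hπ).2.1
    have hπ0 : π ^ j ≠ 0 := pow_ne_zero _ (mem_primesP.mp hπ).1.ne_zero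
    have hzx : π ^ j * (z / π ^ j) = z := EuclideanDomain.mul_div_cancel' hπ0 hdvd
    have hnorm : (π ^ j).norm * (z / π ^ j).norm = n := by rw [← Zsqrtd.norm_mul, hzx, hz]
    have hNq : 0 < (π ^ j).norm := GaussianInt.norm_pos.mpr hπ0
    have hNx : 0 ≤ (z / π ^ j).norm := GaussianInt.norm_nonneg _
    refine mem_triplesLP.mpr ⟨⟨⟨?_, isPrimary_div hzP (hπP.pow j) hdvd⟩, hπ, hj⟩, ?_⟩
    · show (z / π ^ j).norm ≤ n
      nlinarith
    · show (z / π ^ j).norm.natAbs * π.norm.natAbs ^ j = n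
      have h1 := natAbs_norm_cast (z / π ^ j)
      have h2 := natAbs_norm_cast π
      have : (((z / π ^ j).norm.natAbs * π.norm.natAbs ^ j : ℕ) : ℤ) = n := by
        rw [Nat.cast_mul, Nat.cast_pow, h1, h2, ← norm_pow', mul_comm, hnorm]
      exact_mod_cast this
  · rintro ⟨x, π, j⟩ ht
    have hπ0 : π ^ j ≠ 0 := pow_ne_zero _ (mem_primesP.mp (mem_triplesLP.mp ht).1.2.1).1.ne_zero
    simp only [Prod.mk.injEq, and_true]
    exact mul_div_cancel_right₀ x hπ0
  · rintro ⟨z, π, j⟩ ht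
    obtain ⟨⟨-, hπ, -⟩, hdvd⟩ := mem_triplesRP.mp ht
    have hπ0 : π ^ j ≠ 0 := pow_ne_zero _ (mem_primesP.mp hπ).1.ne_zero
    simp only [Prod.mk.injEq, and_true]
    rw [mul_comm]
    exact EuclideanDomain.mul_div_cancel' hπ0 hdvd
  · rintro ⟨x, π, j⟩ ht
    obtain ⟨⟨⟨-, hxP⟩, hπ, hj⟩, -⟩ := mem_triplesLP.mp ht
    have hπP := (mem_primesP.mp hπ).2.1
    obtain ⟨hj1, -⟩ := mem_Icc.mp hj
    simp only
    rw [hψ _ _ hxP (hπP.pow j), hψ.map_pow hπP hj1]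
    ring

/-! ### The Dirichlet series `D_ψ`, `P_ψ`, `Q_ψ` and `D_ψ = e^{Q_ψ}` -/

section LSeriesLayer

variable {ψ : ℤ[i] → ℂ}

/-- `#(primary elements of norm n) ≤ #normEq n`. [folklore] -/
theorem card_primaryNormEq_le (n : ℕ) : (primaryNormEq n).card ≤ (normEq n).card := by
  rw [← filter_isPrimary_normEq]
  exact card_filter_le _ _

/-- `‖c_ψ(n)‖ ≤ #{x : N(x) = n}` when `|ψ| ≤ 1` on primary elements. [folklore] -/
theorem norm_cCoeffP_le (hbd : ∀ z, IsPrimary z → ‖ψ z‖ ≤ 1) (n : ℕ) :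
    ‖cCoeffP ψ n‖ ≤ (normEq n).card := by
  calc ‖cCoeffP ψ n‖ ≤ ∑ x ∈ primaryNormEq n, ‖ψ x‖ := norm_sum_le _ _
    _ ≤ ∑ _x ∈ primaryNormEq n, (1 : ℝ) := sum_le_sum fun x hx ↦ hbd x (mem_primaryNormEq.mp hx).2
    _ = (primaryNormEq n).card := by rw [sum_const, nsmul_eq_mul, mul_one]
    _ ≤ (normEq n).card := by exact_mod_cast card_primaryNormEq_le n

/-- The `L`-series of `c_ψ` converges absolutely for `Re s > 1` (majorant `c_0 = #normEq`).
[folklore] -/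
theorem LSeriesSummable_cCoeffP (hbd : ∀ z, IsPrimary z → ‖ψ z‖ ≤ 1) {s : ℂ} (hs : 1 < s.re) :
    LSeriesSummable (cCoeffP ψ) s := by
  refine Summable.of_norm_bounded (GaussianHecke.LSeriesSummable_cCoeff 0 hs).norm fun n ↦ norm_term_le s ?_
  rw [GaussianHecke.cCoeff_zero, Complex.norm_natCast]
  exact norm_cCoeffP_le hbd n

/-- The abscissa of absolute convergence of `c_ψ` is at most `1`. [folklore] -/
theorem abscissa_cCoeffP_le (hbd : ∀ z, IsPrimary z → ‖ψ z‖ ≤ 1) : abscissaOfAbsConv (cCoeffP ψ) ≤ 1 :=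
  abscissaOfAbsConv_le_of_forall_lt_LSeriesSummable fun y hy ↦
    LSeriesSummable_cCoeffP hbd (by simpa using hy)

/-- `c_ψ(1) = ψ(1)` (the only primary element of norm `1` is `1`). [folklore] -/
theorem cCoeffP_one (ψ : ℤ[i] → ℂ) : cCoeffP ψ 1 = ψ 1 := by
  rw [cCoeffP, primaryNormEq_one, sum_singleton]

/-- `card (pairsNormP n) ≤ card (normEq n)`: `(π, j) ↦ π^j` is injective on primary prime powers
(unique factorisation and uniqueness of the primary associate). [folklore] -/
theorem card_pairsNormP_le (n : ℕ) : (pairsNormP n).card ≤ (normEq n).card := by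
  refine Finset.card_le_card_of_injOn (fun p ↦ p.1 ^ p.2) (fun p hp ↦ ?_) ?_
  · obtain ⟨hπ, hj, hN⟩ := mem_pairsNormP.mp hp
    rw [Finset.mem_coe, mem_normEq, norm_pow', ← natAbs_norm_cast, ← hN]
    push_cast
    rfl
  · rintro ⟨π, j⟩ hp ⟨π', j'⟩ hp' (h : π ^ j = π' ^ j')
    obtain ⟨hπ, hj, -⟩ := mem_pairsNormP.mp hp
    obtain ⟨hπ', hj', -⟩ := mem_pairsNormP.mp hp'
    obtain ⟨hP, hQ, -⟩ := mem_primesP.mp hπ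
    obtain ⟨hP', hQ', -⟩ := mem_primesP.mp hπ'
    have hj1 : 1 ≤ j := (mem_Icc.mp hj).1
    have hdvd : π ∣ π' ^ j' := by
      rw [← h]; exact dvd_pow_self π (by omega)
    have hππ' : π = π' :=
      hQ.eq_of_associated hQ' (hP.associated_of_dvd hP' (hP.dvd_of_dvd_pow hdvd))
    subst hππ'
    have hN2 : 2 ≤ π.norm.natAbs := by
      have h2 : 2 ≤ π.norm := two_le_norm_of_prime hP
      have := natAbs_norm_cast π
      omega
    have hjj : j = j' := by
      have h2 := congrArg (fun z : ℤ[i] ↦ z.norm.natAbs) h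
      simp only [norm_pow', Int.natAbs_pow] at h2
      exact Nat.pow_right_injective hN2 h2
    rw [hjj]

/-- `‖l_ψ(n)‖ ≤ log n · #{x : N(x) = n}` when `|ψ| ≤ 1` on primary elements. [folklore] -/
theorem norm_lCoeffP_le (hbd : ∀ z, IsPrimary z → ‖ψ z‖ ≤ 1) (n : ℕ) :
    ‖lCoeffP ψ n‖ ≤ Real.log n * (normEq n).card := by
  have hlog : ∀ p ∈ pairsNormP n, ‖(Real.log (p.1.norm : ℝ) : ℂ) * ψ p.1 ^ p.2‖ ≤ Real.log n := by
    intro p hp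
    obtain ⟨hπ, hj, hN⟩ := mem_pairsNormP.mp hp
    obtain ⟨hP, hQ, -⟩ := mem_primesP.mp hπ
    have hN1 : (1 : ℝ) ≤ (p.1.norm : ℝ) := by
      have := two_le_norm_of_prime hP
      have h1 : (1 : ℤ) ≤ p.1.norm := by omega
      exact_mod_cast h1
    have hj1 : 1 ≤ p.2 := (mem_Icc.mp hj).1
    have hψ1 : ‖ψ p.1 ^ p.2‖ ≤ 1 := by
      rw [norm_pow]; exact pow_le_one₀ (norm_nonneg _) (hbd _ hQ)
    rw [norm_mul, Complex.norm_real, Real.norm_of_nonneg (Real.log_nonneg hN1)]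
    have hn : (n : ℝ) = (p.1.norm : ℝ) ^ p.2 := by
      rw [← hN]; push_cast; rw [natAbs_norm_real]
    rw [hn, Real.log_pow]
    have h0 := Real.log_nonneg hN1
    have hj1' : (1 : ℝ) ≤ p.2 := by exact_mod_cast hj1
    calc Real.log (p.1.norm : ℝ) * ‖ψ p.1 ^ p.2‖ ≤ Real.log (p.1.norm : ℝ) * 1 := by gcongr
      _ ≤ (p.2 : ℝ) * Real.log (p.1.norm : ℝ) := by nlinarith
  calc ‖lCoeffP ψ n‖ ≤ ∑ p ∈ pairsNormP n, ‖(Real.log (p.1.norm : ℝ) : ℂ) * ψ p.1 ^ p.2‖ :=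
        norm_sum_le _ _
    _ ≤ ∑ _p ∈ pairsNormP n, Real.log n := sum_le_sum hlog
    _ = Real.log n * (pairsNormP n).card := by rw [sum_const, nsmul_eq_mul, mul_comm]
    _ ≤ Real.log n * (normEq n).card :=
        mul_le_mul_of_nonneg_left (by exact_mod_cast card_pairsNormP_le n) (Real.log_natCast_nonneg n)

/-- The `L`-series of `l_ψ` converges absolutely for `Re s > 1`. [folklore] -/
theorem LSeriesSummable_lCoeffP (hbd : ∀ z, IsPrimary z → ‖ψ z‖ ≤ 1) {s : ℂ} (hs : 1 < s.re) :
    LSeriesSummable (lCoeffP ψ) s := by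
  have hlog : LSeriesSummable (logMul (GaussianHecke.cCoeff 0)) s :=
    LSeriesSummable_logMul_of_lt_re ((GaussianHecke.abscissa_cCoeff_le 0).trans_lt (by exact_mod_cast hs))
  refine Summable.of_norm_bounded hlog.norm fun n ↦ norm_term_le s ?_
  rw [logMul, norm_mul, GaussianHecke.cCoeff_zero, Complex.norm_natCast, ← Complex.natCast_log,
    Complex.norm_real, Real.norm_of_nonneg (Real.log_natCast_nonneg n)]
  exact norm_lCoeffP_le hbd n

/-- The abscissa of absolute convergence of `l_ψ` is at most `1`. [folklore] -/
theorem abscissa_lCoeffP_le (hbd : ∀ z, IsPrimary z → ‖ψ z‖ ≤ 1) : abscissaOfAbsConv (lCoeffP ψ) ≤ 1 :=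
  abscissaOfAbsConv_le_of_forall_lt_LSeriesSummable fun y hy ↦
    LSeriesSummable_lCoeffP hbd (by simpa using hy)

/-- **`D_ψ(s) = ∑_n c_ψ(n) n^{-s}`** (`= L(s, ψ)` of FI (16.17) for `Re s > 1`). [cite: FriedlanderIwaniecAnnals1998, (16.17)] -/
def dSeries (ψ : ℤ[i] → ℂ) (s : ℂ) : ℂ := LSeries (cCoeffP ψ) s

/-- **`P_ψ(s) = ∑_{π, j ≥ 1} log N(π) ψ(π)^j N(π)^{-js}`** (`= -D_ψ'/D_ψ`). [folklore] -/
def pSeries (ψ : ℤ[i] → ℂ) (s : ℂ) : ℂ := LSeries (lCoeffP ψ) s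

/-- `q_ψ(n) = ∑_{(π, j) : N(π)^j = n} j⁻¹ ψ(π)^j`, the coefficients of `Q_ψ = log D_ψ`. [folklore] -/
def qCoeffP (ψ : ℤ[i] → ℂ) (n : ℕ) : ℂ := ∑ p ∈ pairsNormP n, ψ p.1 ^ p.2 / p.2

/-- `log n · q_ψ(n) = l_ψ(n)`. [folklore] -/
theorem logMul_qCoeffP (ψ : ℤ[i] → ℂ) : logMul (qCoeffP ψ) = lCoeffP ψ := by
  funext n
  rw [logMul, qCoeffP, lCoeffP, mul_sum]
  refine sum_congr rfl fun p hp ↦ ?_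
  obtain ⟨-, hj, hN⟩ := mem_pairsNormP.mp hp
  have hj0 : (p.2 : ℂ) ≠ 0 := by
    have := (mem_Icc.mp hj).1
    exact_mod_cast (show p.2 ≠ 0 by omega)
  have hn : (n : ℝ) = (p.1.norm : ℝ) ^ p.2 := by
    rw [← hN]; push_cast; rw [natAbs_norm_real]
  rw [← Complex.natCast_log, hn, Real.log_pow]
  push_cast
  field_simp

/-- `‖q_ψ(n)‖ ≤ #{x : N(x) = n}`. [folklore] -/
theorem norm_qCoeffP_le (hbd : ∀ z, IsPrimary z → ‖ψ z‖ ≤ 1) (n : ℕ) :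
    ‖qCoeffP ψ n‖ ≤ (normEq n).card := by
  have h1 : ∀ p ∈ pairsNormP n, ‖ψ p.1 ^ p.2 / (p.2 : ℂ)‖ ≤ 1 := by
    intro p hp
    obtain ⟨hπ, hj, -⟩ := mem_pairsNormP.mp hp
    have hj1 : (1 : ℝ) ≤ p.2 := by exact_mod_cast (mem_Icc.mp hj).1
    have hψ1 : ‖ψ p.1 ^ p.2‖ ≤ 1 := by
      rw [norm_pow]; exact pow_le_one₀ (norm_nonneg _) (hbd _ (mem_primesP.mp hπ).2.1)
    rw [norm_div, Complex.norm_natCast]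
    exact (div_le_one (by linarith)).mpr (hψ1.trans hj1)
  calc ‖qCoeffP ψ n‖ ≤ ∑ p ∈ pairsNormP n, ‖ψ p.1 ^ p.2 / (p.2 : ℂ)‖ := norm_sum_le _ _
    _ ≤ ∑ _p ∈ pairsNormP n, (1 : ℝ) := sum_le_sum h1
    _ = (pairsNormP n).card := by rw [sum_const, nsmul_eq_mul, mul_one]
    _ ≤ (normEq n).card := by exact_mod_cast card_pairsNormP_le n

/-- The `L`-series of `q_ψ` converges absolutely for `Re s > 1`. [folklore] -/
theorem LSeriesSummable_qCoeffP (hbd : ∀ z, IsPrimary z → ‖ψ z‖ ≤ 1) {s : ℂ} (hs : 1 < s.re) :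
    LSeriesSummable (qCoeffP ψ) s := by
  refine Summable.of_norm_bounded (GaussianHecke.LSeriesSummable_cCoeff 0 hs).norm fun n ↦ norm_term_le s ?_
  rw [GaussianHecke.cCoeff_zero, Complex.norm_natCast]
  exact norm_qCoeffP_le hbd n

/-- The abscissa of absolute convergence of `q_ψ` is at most `1`. [folklore] -/
theorem abscissa_qCoeffP_le (hbd : ∀ z, IsPrimary z → ‖ψ z‖ ≤ 1) : abscissaOfAbsConv (qCoeffP ψ) ≤ 1 :=
  abscissaOfAbsConv_le_of_forall_lt_LSeriesSummable fun y hy ↦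
    LSeriesSummable_qCoeffP hbd (by simpa using hy)

/-- **`Q_ψ(s) = ∑_{π, j ≥ 1} j⁻¹ ψ(π)^j N(π)^{-js}`** (`= log D_ψ(s)`). [folklore] -/
def qSeries (ψ : ℤ[i] → ℂ) (s : ℂ) : ℂ := LSeries (qCoeffP ψ) s

/-- `Q_ψ' = -P_ψ` on `Re s > 1`. [folklore] -/
theorem hasDerivAt_qSeries (hbd : ∀ z, IsPrimary z → ‖ψ z‖ ≤ 1) {s : ℂ} (hs : 1 < s.re) :
    HasDerivAt (qSeries ψ) (-pSeries ψ s) s := by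
  have h := LSeries_hasDerivAt ((abscissa_qCoeffP_le hbd).trans_lt (by exact_mod_cast hs) :
    abscissaOfAbsConv (qCoeffP ψ) < s.re)
  rw [logMul_qCoeffP] at h
  exact h

/-- **`D_ψ'(s) = -D_ψ(s) P_ψ(s)` for `Re s > 1`** (from `c_ψ ⋆ l_ψ = log · c_ψ`).
[cite: HeckeMathZ1920, §7] -/
theorem hasDerivAt_dSeries (hmul : IsPrimaryMul ψ) (hbd : ∀ z, IsPrimary z → ‖ψ z‖ ≤ 1) {s : ℂ}
    (hs : 1 < s.re) : HasDerivAt (dSeries ψ) (-(dSeries ψ s * pSeries ψ s)) s := by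
  have habs : abscissaOfAbsConv (cCoeffP ψ) < s.re :=
    (abscissa_cCoeffP_le hbd).trans_lt (by exact_mod_cast hs)
  have h1 : HasDerivAt (LSeries (cCoeffP ψ)) (-LSeries (logMul (cCoeffP ψ)) s) s :=
    LSeries_hasDerivAt habs
  have hconv : logMul (cCoeffP ψ) = LSeries.convolution (cCoeffP ψ) (lCoeffP ψ) := by
    funext n
    rw [logMul, convolution_cCoeffP_lCoeffP hmul, Complex.natCast_log]
  rw [hconv, LSeries_convolution' (LSeriesSummable_cCoeffP hbd hs) (LSeriesSummable_lCoeffP hbd hs)] at h1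
  exact h1

/-- `D_ψ(σ) → c_ψ(1) = ψ(1)` as `σ → +∞`. [folklore] -/
theorem tendsto_dSeries_atTop (hbd : ∀ z, IsPrimary z → ‖ψ z‖ ≤ 1) :
    Tendsto (fun x : ℝ ↦ dSeries ψ x) atTop (𝓝 (ψ 1)) := by
  have h := LSeries.tendsto_atTop (f := cCoeffP ψ)
    ((abscissa_cCoeffP_le hbd).trans_lt (by exact_mod_cast EReal.coe_lt_top 1))
  rwa [cCoeffP_one] at h

/-- `Q_ψ(σ) → q_ψ(1) = 0` as `σ → +∞`. [folklore] -/
theorem tendsto_qSeries_atTop (hbd : ∀ z, IsPrimary z → ‖ψ z‖ ≤ 1) :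
    Tendsto (fun x : ℝ ↦ qSeries ψ x) atTop (𝓝 0) := by
  have h := LSeries.tendsto_atTop (f := qCoeffP ψ)
    ((abscissa_qCoeffP_le hbd).trans_lt (by exact_mod_cast EReal.coe_lt_top 1))
  have h1 : qCoeffP ψ 1 = 0 := by
    rw [qCoeffP]
    refine sum_eq_zero fun p hp ↦ ?_
    exfalso
    obtain ⟨hπ, hj, hN⟩ := mem_pairsNormP.mp hp
    have h2 : 2 ≤ p.1.norm.natAbs := by
      have := two_le_norm_of_prime (mem_primesP.mp hπ).1
      have := natAbs_norm_cast p.1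
      omega
    have : 2 ≤ p.1.norm.natAbs ^ p.2 :=
      h2.trans (Nat.le_self_pow (by have := (mem_Icc.mp hj).1; omega) _)
    omega
  rwa [h1] at h

/-- **`D_ψ(s) = ψ(1) · exp(Q_ψ(s))` for `Re s > 1`** — the Euler product
`L(s, ψ) = ∏_𝔭 (1 - ψ(𝔭) N𝔭^{-s})⁻¹` in logarithmic form (`ψ(1) = 1` for a genuine character).
[cite: FriedlanderIwaniecAnnals1998, (16.17)] -/
theorem dSeries_eq_mul_exp (hmul : IsPrimaryMul ψ) (hbd : ∀ z, IsPrimary z → ‖ψ z‖ ≤ 1) {s : ℂ}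
    (hs : 1 < s.re) : dSeries ψ s = ψ 1 * Complex.exp (qSeries ψ s) := by
  let F : ℂ → ℂ := fun z ↦ dSeries ψ z * Complex.exp (-qSeries ψ z)
  have hderiv : ∀ z : ℂ, 1 < z.re → HasDerivAt F 0 z := by
    intro z hz
    have h1 := hasDerivAt_dSeries hmul hbd hz
    have h2 := ((hasDerivAt_qSeries hbd hz).neg).cexp
    exact (h1.mul h2).congr_deriv (by ring)
  have hconst : ∀ z : ℂ, 1 < z.re → F z = F s := by
    intro z hz
    refine convex_halfSpace_re_gt 1 |>.is_const_of_fderivWithin_eq_zero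
      (fun w hw ↦ (hderiv w hw).differentiableAt.differentiableWithinAt) (fun w hw ↦ ?_) hz hs
    rw [fderivWithin_eq_fderiv (uniqueDiffWithinAt_of_mem_nhds (GaussianHecke.halfPlane_mem_nhds hw))
      (hderiv w hw).differentiableAt, (hderiv w hw).hasFDerivAt.fderiv]
    ext
    simp
  have hlim : Tendsto (fun x : ℝ ↦ F x) atTop (𝓝 (ψ 1 * Complex.exp (-0))) :=
    (tendsto_dSeries_atTop hbd).mul ((tendsto_qSeries_atTop hbd).neg.cexp)
  have hlim' : Tendsto (fun x : ℝ ↦ F x) atTop (𝓝 (F s)) := by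
    refine tendsto_const_nhds.congr' ?_
    filter_upwards [eventually_gt_atTop 1] with x hx
    exact (hconst x (by simpa using hx)).symm
  have hFs : F s = ψ 1 := by
    have := tendsto_nhds_unique hlim' hlim
    rwa [neg_zero, Complex.exp_zero, mul_one] at this
  have : dSeries ψ s * Complex.exp (-qSeries ψ s) = ψ 1 := hFs
  calc dSeries ψ s = dSeries ψ s * Complex.exp (-qSeries ψ s) * Complex.exp (qSeries ψ s) := by
        rw [mul_assoc, ← Complex.exp_add, neg_add_cancel, Complex.exp_zero, mul_one]
    _ = ψ 1 * Complex.exp (qSeries ψ s) := by rw [this]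

/-- **`D_ψ(s) ≠ 0` for `Re s > 1`** when `ψ(1) ≠ 0`. [cite: FriedlanderIwaniecAnnals1998, (16.17)] -/
theorem dSeries_ne_zero (hmul : IsPrimaryMul ψ) (hbd : ∀ z, IsPrimary z → ‖ψ z‖ ≤ 1) (h1 : ψ 1 ≠ 0)
    {s : ℂ} (hs : 1 < s.re) : dSeries ψ s ≠ 0 := by
  rw [dSeries_eq_mul_exp hmul hbd hs]
  exact mul_ne_zero h1 (Complex.exp_ne_zero _)

/-- `P_ψ(s) = -D_ψ'(s)/D_ψ(s)` for `Re s > 1`. [folklore] -/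
theorem pSeries_eq_neg_deriv_div (hmul : IsPrimaryMul ψ) (hbd : ∀ z, IsPrimary z → ‖ψ z‖ ≤ 1)
    (h1 : ψ 1 ≠ 0) {s : ℂ} (hs : 1 < s.re) :
    pSeries ψ s = -deriv (dSeries ψ) s / dSeries ψ s := by
  rw [(hasDerivAt_dSeries hmul hbd hs).deriv, neg_neg, mul_div_cancel_left₀ _ (dSeries_ne_zero hmul hbd h1 hs)]

/-- `‖D_ψ(s)‖ = exp(Re Q_ψ(s))` for `Re s > 1` when `ψ(1) = 1`. [folklore] -/
theorem norm_dSeries_eq (hmul : IsPrimaryMul ψ) (hbd : ∀ z, IsPrimary z → ‖ψ z‖ ≤ 1) (h1 : ψ 1 = 1)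
    {s : ℂ} (hs : 1 < s.re) : ‖dSeries ψ s‖ = Real.exp (qSeries ψ s).re := by
  rw [dSeries_eq_mul_exp hmul hbd hs, h1, one_mul, Complex.norm_exp]

end LSeriesLayer

end GaussianPrimaryVM

end Literature.NumberTheory.LFunctions
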